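import Mathlib.Analysis.SpecialFunctions.ImproperIntegrals
import Summits.RiemannHypothesis.RiemannHypothesis.Theorems.JensenPolynomialsLaplaceWindow

/-!
# Route `JensenPolynomials`, FAR crux `XiWindowZeroFreeRelFar` (B1-rel far) — contour tools VII: the whole line —
window + left piece + right tail ⇒ a relative Laplace approximation (RH-FREE; cell rh-jensen, HUMAN RULING D-0040)

Stub S3 `stub_laplaceFar` (theory g8's line «far-gumbel», item `stmt-RiemannHypothesis-19465`) integrates
`F(x) = e^{P(x)}·Q(x)` along the horizontal line through the exact saddle `x_s` of the phase `P` (`P x = Ψ(x + iy_s)`),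
from the connector abscissa `a₀ = υ − 2` to `∞`. This file assembles the pointwise information into ONE estimate
(`norm_integral_line_sub_main_le`): given

* the cubic window hypothesis at `x_s` (`‖P x − P x_s + c(x−x_s)²‖ ≤ M|x−x_s|³` on `|x−x_s| ≤ δ`, `Re c > 0`, `Mδ ≤ Re c/2`),
* an amplitude with `‖Q x − 1‖ ≤ η` on `[a₀, ∞)`,
* descent outside the window: `Re(P x − P x_s) ≤ −A` on `[a₀, x_s − δ]` and `Re(P x − P x_s) ≤ −A − (x − x_s − δ)` on
  `[x_s + δ, ∞)`,
* integrability of `F` on `(a₀, ∞)` and continuity of `P`,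

one has `‖∫_{a₀}^∞ e^{P}Q − e^{P(x_s)}(π/c)^{1/2}‖ ≤ e^{Re P(x_s)}·(4M/(Re c)² + (1+η)e^{−Re c·δ²/2}√(2π/Re c) + η√(2π/Re c)
 + (1+η)e^{−A}(x_s − δ − a₀ + 1))` — the input of `WindowEGF.laplace_log_of_rel_approx`.
WHAT THIS IS NOT: bookkeeping of set integrals; nothing here bears on the zeros of `ζ` or the truth of RH.
-/

noncomputable section
-- D-0017: `Summit.RiemannHypothesis.RiemannHypothesis.…` duplicates the namespace BY DESIGN (single-problem summit).
set_option linter.dupNamespace false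

namespace Summit.RiemannHypothesis.RiemannHypothesis.Theorems.JensenPolynomials.WindowEGF

open MeasureTheory Set Filter
open scoped Topology Real

/-- Left piece: on a bounded interval where `Re(P x − P x_s) ≤ −A` and `‖Q‖ ≤ 1 + η`,
`‖∫_{Ioc a₀ b} e^{P}Q‖ ≤ (1+η)e^{Re P(x_s) − A}·(b − a₀)` (`a₀ ≤ b`). -/
theorem norm_integral_left_piece_le {P Q : ℝ → ℂ} {a₀ b x_s A η : ℝ} (hab : a₀ ≤ b)
    (hdesc : ∀ x ∈ Ioc a₀ b, (P x - P x_s).re ≤ -A) (hQ : ∀ x ∈ Ioc a₀ b, ‖Q x‖ ≤ 1 + η) :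
    ‖∫ x in Ioc a₀ b, Complex.exp (P x) * Q x‖ ≤ (1 + η) * Real.exp ((P x_s).re - A) * (b - a₀) := by
  have h := norm_setIntegral_le_of_norm_le_const (μ := volume) (s := Ioc a₀ b)
    (f := fun x => Complex.exp (P x) * Q x) (C := (1 + η) * Real.exp ((P x_s).re - A)) (by simp) (fun x hx => by
      rw [norm_mul, Complex.norm_exp]
      have h1 : (P x).re ≤ (P x_s).re - A := by
        have := hdesc x hx; rw [Complex.sub_re] at this; linarith
      calc Real.exp (P x).re * ‖Q x‖ ≤ Real.exp ((P x_s).re - A) * (1 + η) :=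
            mul_le_mul (Real.exp_monotone h1) (hQ x hx) (norm_nonneg _) (Real.exp_pos _).le
        _ = (1 + η) * Real.exp ((P x_s).re - A) := mul_comm _ _)
  rw [Real.volume_real_Ioc, max_eq_left (by linarith)] at h
  exact h

/-- Right tail: where `Re(P x − P x_s) ≤ −A − (x − b)` on `(b, ∞)` and `‖Q‖ ≤ 1 + η`,
`‖∫_{Ioi b} e^{P}Q‖ ≤ (1+η)e^{Re P(x_s) − A}`. -/
theorem norm_integral_right_tail_le {P Q : ℝ → ℂ} {b x_s A η : ℝ}
    (hdesc : ∀ x ∈ Ioi b, (P x - P x_s).re ≤ -A - (x - b)) (hQ : ∀ x ∈ Ioi b, ‖Q x‖ ≤ 1 + η) :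
    ‖∫ x in Ioi b, Complex.exp (P x) * Q x‖ ≤ (1 + η) * Real.exp ((P x_s).re - A) := by
  set C : ℝ := (1 + η) * Real.exp ((P x_s).re - A + b) with hC
  have hgi : IntegrableOn (fun x : ℝ => C * Real.exp (-1 * x)) (Ioi b) :=
    (exp_neg_integrableOn_Ioi b one_pos).const_mul C
  have h1 : ‖∫ x in Ioi b, Complex.exp (P x) * Q x‖ ≤ ∫ x in Ioi b, C * Real.exp (-1 * x) := by
    refine norm_integral_le_of_norm_le hgi ((ae_restrict_iff' measurableSet_Ioi).2 (Eventually.of_forall fun x hx => ?_))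
    rw [norm_mul, Complex.norm_exp]
    have h2 : (P x).re ≤ (P x_s).re - A - (x - b) := by
      have := hdesc x hx; rw [Complex.sub_re] at this; linarith
    have h3 : Real.exp (P x).re ≤ Real.exp ((P x_s).re - A + b) * Real.exp (-1 * x) := by
      rw [← Real.exp_add]; apply Real.exp_monotone; linarith
    calc Real.exp (P x).re * ‖Q x‖ ≤ (Real.exp ((P x_s).re - A + b) * Real.exp (-1 * x)) * (1 + η) :=
          mul_le_mul h3 (hQ x hx) (norm_nonneg _) (by positivity)
      _ = C * Real.exp (-1 * x) := by rw [hC]; ring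
  have h4 : (∫ x in Ioi b, C * Real.exp (-1 * x)) = C * Real.exp (-b) := by
    rw [integral_const_mul]
    simp only [neg_mul, one_mul]
    rw [integral_exp_neg_Ioi]
  rw [h4] at h1
  have h5 : C * Real.exp (-b) = (1 + η) * Real.exp ((P x_s).re - A) := by
    rw [hC, mul_assoc, ← Real.exp_add]; ring_nf
  linarith

/-- **The whole line («lineUpper» + «lineLower» assembled).** Let `P` be continuous, `a₀ ≤ x_s − δ`, `0 ≤ δ`, and suppose:
the cubic window hypothesis `‖P x − P x_s + c(x−x_s)²‖ ≤ M|x−x_s|³` on `|x − x_s| ≤ δ` with `Re c > 0`, `0 ≤ M`, `Mδ ≤ Re c/2`;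
an amplitude `Q` with `‖Q x − 1‖ ≤ η` on `[a₀, ∞)`; descent `Re(P x − P x_s) ≤ −A` on `(a₀, x_s − δ]` and
`Re(P x − P x_s) ≤ −A − (x − (x_s + δ))` on `(x_s + δ, ∞)`; and `x ↦ e^{P x}Q x` integrable on `(a₀, ∞)`. Then
`‖∫_{a₀}^∞ e^{P}Q − e^{P(x_s)}(π/c)^{1/2}‖ ≤
 e^{Re P(x_s)}·(4M/(Re c)² + e^{−Re c·δ²/2}√(2π/Re c) + η√(2π/Re c) + (1+η)e^{−A}(x_s − δ − a₀ + 1))`. -/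
theorem norm_integral_line_sub_main_le {P Q : ℝ → ℂ} (hP : Continuous P) {a₀ x_s δ M A η : ℝ} {c : ℂ}
    (hc : 0 < c.re) (hδ : 0 ≤ δ) (ha : a₀ ≤ x_s - δ) (hM : 0 ≤ M) (hMδ : M * δ ≤ c.re / 2) (hη : 0 ≤ η)
    (hT : ∀ x, |x - x_s| ≤ δ → ‖P x - P x_s + c * (x - x_s) ^ 2‖ ≤ M * |x - x_s| ^ 3)
    (hQ : ∀ x, a₀ ≤ x → ‖Q x - 1‖ ≤ η)
    (hL : ∀ x ∈ Ioc a₀ (x_s - δ), (P x - P x_s).re ≤ -A)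
    (hR : ∀ x ∈ Ioi (x_s + δ), (P x - P x_s).re ≤ -A - (x - (x_s + δ)))
    (hint : IntegrableOn (fun x : ℝ => Complex.exp (P x) * Q x) (Ioi a₀)) :
    ‖(∫ x in Ioi a₀, Complex.exp (P x) * Q x) - Complex.exp (P x_s) * ((π : ℂ) / c) ^ (1 / 2 : ℂ)‖ ≤
      Real.exp (P x_s).re * (4 * M / c.re ^ 2 + Real.exp (-(c.re * δ ^ 2 / 2)) * Real.sqrt (2 * π / c.re) +
        η * Real.sqrt (2 * π / c.re) + (1 + η) * Real.exp (-A) * (x_s - δ - a₀ + 1)) := by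
  set F : ℝ → ℂ := fun x => Complex.exp (P x) * Q x with hF
  have hQ' : ∀ x, a₀ ≤ x → ‖Q x‖ ≤ 1 + η := fun x hx => by
    have := hQ x hx
    calc ‖Q x‖ = ‖1 + (Q x - 1)‖ := by ring_nf
      _ ≤ ‖(1 : ℂ)‖ + ‖Q x - 1‖ := norm_add_le _ _
      _ ≤ 1 + η := by rw [norm_one]; linarith
  -- split `Ioi a₀ = Ioc a₀ (x_s−δ) ∪ Ioc (x_s−δ) (x_s+δ) ∪ Ioi (x_s+δ)`
  have hs1 : Ioc a₀ (x_s - δ) ∪ Ioi (x_s - δ) = Ioi a₀ := Ioc_union_Ioi_eq_Ioi ha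
  have hs2 : Ioc (x_s - δ) (x_s + δ) ∪ Ioi (x_s + δ) = Ioi (x_s - δ) := Ioc_union_Ioi_eq_Ioi (by linarith)
  have hI1 : IntegrableOn F (Ioc a₀ (x_s - δ)) := hint.mono_set (hs1 ▸ subset_union_left)
  have hI2' : IntegrableOn F (Ioi (x_s - δ)) := hint.mono_set (hs1 ▸ subset_union_right)
  have hI2 : IntegrableOn F (Ioc (x_s - δ) (x_s + δ)) := hI2'.mono_set (hs2 ▸ subset_union_left)
  have hI3 : IntegrableOn F (Ioi (x_s + δ)) := hI2'.mono_set (hs2 ▸ subset_union_right)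
  have hsplit : (∫ x in Ioi a₀, F x) = (∫ x in Ioc a₀ (x_s - δ), F x) + (∫ x in Ioc (x_s - δ) (x_s + δ), F x) +
      ∫ x in Ioi (x_s + δ), F x := by
    rw [← hs1, setIntegral_union (Ioc_disjoint_Ioi le_rfl) measurableSet_Ioi hI1 hI2', ← hs2,
      setIntegral_union (Ioc_disjoint_Ioi le_rfl) measurableSet_Ioi hI2 hI3, add_assoc]
  -- the window piece
  have hwin : (∫ x in Ioc (x_s - δ) (x_s + δ), F x) =
      Complex.exp (P x_s) * ((∫ x in Icc (x_s - δ) (x_s + δ), Complex.exp (P x - P x_s)) +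
        ∫ x in Icc (x_s - δ) (x_s + δ), Complex.exp (P x - P x_s) * (Q x - 1)) := by
    rw [← integral_Icc_eq_integral_Ioc]
    have hI2c : IntegrableOn F (Icc (x_s - δ) (x_s + δ)) :=
      (integrableOn_Icc_iff_integrableOn_Ioc (μ := volume)).2 hI2
    have hcont : IntegrableOn (fun x => Complex.exp (P x - P x_s)) (Icc (x_s - δ) (x_s + δ)) :=
      ((hP.sub continuous_const).cexp).continuousOn.integrableOn_compact isCompact_Icc
    have hprod : IntegrableOn (fun x => Complex.exp (P x - P x_s) * (Q x - 1)) (Icc (x_s - δ) (x_s + δ)) := by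
      have h1 : IntegrableOn (fun x => Complex.exp (-P x_s) * F x) (Icc (x_s - δ) (x_s + δ)) := hI2c.const_mul _
      have h2 := h1.sub hcont
      refine h2.congr_fun (fun x _ => ?_) measurableSet_Icc
      simp only [hF, Pi.sub_apply]
      rw [sub_eq_add_neg (P x), Complex.exp_add]; ring
    rw [← integral_add hcont hprod, ← integral_const_mul]
    refine setIntegral_congr_fun measurableSet_Icc fun x _ => ?_
    simp only [hF]
    rw [sub_eq_add_neg (P x), Complex.exp_add, Complex.exp_neg]
    field_simp
    ring
  -- bounds
  have hB1 := norm_integral_left_piece_le (P := P) (Q := Q) (x_s := x_s) (A := A) ha hL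
    (fun x hx => hQ' x (le_of_lt hx.1))
  have hB3 := norm_integral_right_tail_le (P := P) (Q := Q) (x_s := x_s) (A := A) (b := x_s + δ) hR
    (fun x hx => hQ' x (by linarith [(show x_s + δ < x from hx)]))
  have hW1 := norm_integral_window_phase_sub_main_le hP hc hδ hM hMδ hT
  have hW2 := norm_integral_window_phase_mul_le (Q := fun x => Q x - 1) hc hM hMδ hη hT (fun x hx =>
    hQ x (by linarith [hx.1]))
  -- assemble
  have he : ‖Complex.exp (P x_s)‖ = Real.exp (P x_s).re := Complex.norm_exp _
  rw [hsplit, hwin]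
  have key : (∫ x in Ioc a₀ (x_s - δ), F x) +
        Complex.exp (P x_s) * ((∫ x in Icc (x_s - δ) (x_s + δ), Complex.exp (P x - P x_s)) +
          ∫ x in Icc (x_s - δ) (x_s + δ), Complex.exp (P x - P x_s) * (Q x - 1)) +
        (∫ x in Ioi (x_s + δ), F x) - Complex.exp (P x_s) * ((π : ℂ) / c) ^ (1 / 2 : ℂ) =
      (∫ x in Ioc a₀ (x_s - δ), F x) + (∫ x in Ioi (x_s + δ), F x) +
        Complex.exp (P x_s) * (((∫ x in Icc (x_s - δ) (x_s + δ), Complex.exp (P x - P x_s)) - ((π : ℂ) / c) ^ (1 / 2 : ℂ)) +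
          ∫ x in Icc (x_s - δ) (x_s + δ), Complex.exp (P x - P x_s) * (Q x - 1)) := by ring
  rw [key]
  have hEpos : 0 < Real.exp (P x_s).re := Real.exp_pos _
  calc ‖(∫ x in Ioc a₀ (x_s - δ), F x) + (∫ x in Ioi (x_s + δ), F x) +
        Complex.exp (P x_s) * (((∫ x in Icc (x_s - δ) (x_s + δ), Complex.exp (P x - P x_s)) - ((π : ℂ) / c) ^ (1 / 2 : ℂ)) +
          ∫ x in Icc (x_s - δ) (x_s + δ), Complex.exp (P x - P x_s) * (Q x - 1))‖
      ≤ ‖∫ x in Ioc a₀ (x_s - δ), F x‖ + ‖∫ x in Ioi (x_s + δ), F x‖ +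
          ‖Complex.exp (P x_s)‖ * (‖(∫ x in Icc (x_s - δ) (x_s + δ), Complex.exp (P x - P x_s)) - ((π : ℂ) / c) ^ (1 / 2 : ℂ)‖ +
            ‖∫ x in Icc (x_s - δ) (x_s + δ), Complex.exp (P x - P x_s) * (Q x - 1)‖) := by
        refine (norm_add_le _ _).trans (add_le_add (norm_add_le _ _) ?_)
        rw [norm_mul]
        exact mul_le_mul_of_nonneg_left (norm_add_le _ _) (norm_nonneg _)
    _ ≤ (1 + η) * Real.exp ((P x_s).re - A) * (x_s - δ - a₀) + (1 + η) * Real.exp ((P x_s).re - A) +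
          Real.exp (P x_s).re * ((4 * M / c.re ^ 2 + Real.exp (-(c.re * δ ^ 2 / 2)) * Real.sqrt (2 * π / c.re)) +
            η * Real.sqrt (2 * π / c.re)) := by
        rw [he]
        gcongr
    _ = Real.exp (P x_s).re * (4 * M / c.re ^ 2 + Real.exp (-(c.re * δ ^ 2 / 2)) * Real.sqrt (2 * π / c.re) +
          η * Real.sqrt (2 * π / c.re) + (1 + η) * Real.exp (-A) * (x_s - δ - a₀ + 1)) := by
        rw [show (P x_s).re - A = (P x_s).re + -A by ring, Real.exp_add]; ring

end Summit.RiemannHypothesis.RiemannHypothesis.Theorems.JensenPolynomials.WindowEGF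

end
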